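import Mathlib
import HarnessLib
import Summits.CriticalPhenomena.PercolationContinuityZ3.Theorems.PercTreeValueTetrahedronHarrisGapStubCondHarris
import Literature.Probability.Percolation.BlockResampling

/-!
# Window–Harris sandwich for a finite block (cycle-2 candidate helper, crux `TetrahedronHarrisGap`)

For increasing measurable events `A, A'` and a finite block `B` of edges,
`P_p(A) P_p(A') ≤ ∫ P_p(A | ω off B) · P_p(A' | ω off B) dP_p ≤ P_p(A ∩ A')`:
the law of total covariance over the σ-algebra of the edges off `B` is sign-definite. The right half is
`stub_condHarris` (landed); the left half is Harris for the increasing bounded functions `P_p(· | ω off B)`.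
This is ideator 2's `WindowHarrisSandwich` (cards `harvested-covariance-four-arms`, `mirror-window-influence`)
for windows with FINITE complement, with the conditional expectation written out as `blockCondProb`
(`blockCondProb_ae_eq_condExp` links it to Mathlib's `condExp`).
-/

noncomputable section

open MeasureTheory
open Literature.Probability.Percolation

namespace Summit.CriticalPhenomena.PercolationContinuityZ3.Theorems.TetrahedronHarrisGap

variable {V : Type*} [Countable V] (G : SimpleGraph V) (p : unitInterval)

omit [Countable V] in
/-- `P_p(E | ω off B)` is increasing in `ω` for an increasing event `E` (local copy; the tree copy rides with
`PercTreeValueTetrahedronHarrisGapReduction.lean`). -/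
private theorem blockCondProb_monotone (B : Finset (Sym2 V)) {E : Set (BondConfig V)} (hE : IsUpperSet E) :
    Monotone (blockCondProb G p B E) := by
  intro ω ω' hle
  unfold blockCondProb
  refine Finset.sum_le_sum fun ξ _ => mul_le_mul_of_nonneg_left ?_ measureReal_nonneg
  have hsub : ω \ (↑B : Set (Sym2 V)) ∪ ↑ξ ≤ ω' \ ↑B ∪ ↑ξ :=
    Set.union_subset_union_left _ (Set.sdiff_subset_sdiff_left hle)
  by_cases h : ω \ (↑B : Set (Sym2 V)) ∪ ↑ξ ∈ E
  · rw [Set.indicator_of_mem h, Set.indicator_of_mem (hE hsub h)]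
    simp only [Pi.one_apply, le_refl]
  · rw [Set.indicator_of_notMem h]
    exact Set.indicator_nonneg (fun _ _ => zero_le_one) _

/-- **Lower half of the window–Harris sandwich**: `P_p(A) P_p(A') ≤ ∫ P_p(A | ω off B) P_p(A' | ω off B) dP_p`
for increasing measurable `A, A'` (Harris–FKG for the increasing bounded functions `P_p(· | ω off B)`, plus the
tower property `∫ P_p(E | ω off B) = P_p(E)`). -/
theorem measureReal_mul_le_integral_blockCondProb_mul (B : Finset (Sym2 V)) {A A' : Set (BondConfig V)}
    (hA : IsUpperSet A) (hA' : IsUpperSet A') (hAm : MeasurableSet A) (hA'm : MeasurableSet A') :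
    (bondPercolation G p).real A * (bondPercolation G p).real A' ≤
      ∫ ω, blockCondProb G p B A ω * blockCondProb G p B A' ω ∂(bondPercolation G p) := by
  rw [← integral_blockCondProb_eq G p B hAm, ← integral_blockCondProb_eq G p B hA'm]
  have hb : ∀ (E : Set (BondConfig V)), MeasurableSet E →
      MemLp (blockCondProb G p B E) 2 (bondPercolation G p) := fun E hE =>
    MemLp.of_bound (measurable_blockCondProb G p B hE).aestronglyMeasurable 1
      (ae_of_all _ fun ω => by rw [Real.norm_eq_abs]; exact abs_blockCondProb_le G p B E ω)
  exact harris_fkg_integral_holds G p (blockCondProb_monotone G p B hA) (blockCondProb_monotone G p B hA')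
    (hb A hAm) (hb A' hA'm)

/-- **The window–Harris sandwich for a finite block** (both halves; registered helper of crux
stmt-CriticalPhenomena-7799): for increasing measurable `A, A'` and a finite block `B`,
`P_p(A) P_p(A') ≤ ∫ P_p(A | ω off B) P_p(A' | ω off B) dP_p ≤ P_p(A ∩ A')`. -/
theorem windowHarrisSandwich_finiteBlock :
    ∀ {V : Type*} [Countable V] (G : SimpleGraph V) (p : unitInterval) (B : Finset (Sym2 V))
      {A A' : Set (BondConfig V)}, IsUpperSet A → IsUpperSet A' → MeasurableSet A → MeasurableSet A' →
      (bondPercolation G p).real A * (bondPercolation G p).real A' ≤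
          ∫ ω, blockCondProb G p B A ω * blockCondProb G p B A' ω ∂(bondPercolation G p) ∧
        ∫ ω, blockCondProb G p B A ω * blockCondProb G p B A' ω ∂(bondPercolation G p) ≤
          (bondPercolation G p).real (A ∩ A') :=
  fun G p B _ _ hA hA' hAm hA'm =>
    ⟨measureReal_mul_le_integral_blockCondProb_mul G p B hA hA' hAm hA'm,
      integral_blockCondProb_mul_blockCondProb_le G p B hA hA' hAm hA'm⟩

end Summit.CriticalPhenomena.PercolationContinuityZ3.Theorems.TetrahedronHarrisGap

end
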